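import Literature.AnabelianGeometry.AbsoluteAnabelian.GaloisCyclotomeOpenEmbeddingComp
import HarnessLib

/-!
# [AbsTopIII] Cor. 1.10 (i): `Res_β : H^q(G, μ_Ẑ(G)) → H^q(H, μ_Ẑ(H))` along an ARBITRARY injective open
# homomorphism `β : H ↪ G`

S. Mochizuki, *Topics in Absolute Anabelian Geometry III*, Cor. 1.10 (i) p. 42 (kurims
`paper:url-5493eb38cbb7`): «Here, the asserted "functoriality" is with respect to arbitrary injective open
homomorphisms of profinite groups [cf. also Remark 1.10.1, (iii), below]»; Rmk. 1.10.1 (iii) p. 44: for an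
open injection the compatibility of (a) holds «relative to dividing … by a factor given by the index of the
image».

The tree states the functoriality of Cor. 1.10 (i)(a)/(b) along ISOMORPHISMS `α : G ≃ₜ* G′`
(abc-iut-L4-d1, `galCyclotomeCohomologyMap α q`, `ReconstructionCor110iiPrime.lean`) and along the
FIELD-THEORETIC restriction `res : G_{k′} ↪ G_k` of a finite extension (abc-iut-w5-d201, `galCyclotomeRes
k k′ q`, `GaloisCyclotomeRestriction.lean`).  This file defines the ONE map a consumer binds for print's
sentence — **`galCyclotomeResOE β q`** for ANY injective open `β : H →ₜ* G` of compact Hausdorff groups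
(Mathlib `ContinuousCohomology.map β` with coefficient morphism `galCyclotomeResOECoeff β :
μ_Ẑ(G)|_H ⥲ μ_Ẑ(H)`, VERBATIM the shape of `galCyclotomeRes`, which is its instance at
`β = absGaloisRestrict k k′` by `rfl`: `galCyclotomeRes_eq_galCyclotomeResOE`) — and its calculus:
`galCyclotomeResOE_comp` (contravariant functoriality, from `GaloisCyclotomeOpenEmbeddingComp.lean`),
`galCyclotomeResOE_coe_symm_apply` (at an isomorphism it is abc-iut-L4-d1's transport),
`galCyclotomeResOECoeff_of_forall_eq_conj` (at an inner automorphism `x ↦ τ⁻¹ x τ` the coefficient morphism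
is the action of `τ`, so that Serre's «inner automorphisms act trivially on cohomology» applies:
`ContinuousCohomology.map_one_eq_id_of_inner` / `map_two_eq_id_of_inner`).  With abc-iut-L4-d3's
factorisation `β = Inn(g) ∘ res ∘ iso` (`OpenInjectionFactorsThroughRestriction.lean`) these reduce
print's sentence to the iso and restriction legs already in the tree (assembled in
`AbsTopIII/ReconstructionCor110OpenInjectiveProofs.lean`).

Definitions with bodies: `galCyclotomeResOECoeff`, `galCyclotomeResOE`.  No named fact, no `sorry`.
HONEST FRAMING: topological group theory; nothing here bears on [IUTchIII] Cor. 3.12 or takes a side.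
-/

noncomputable section

open CategoryTheory Function

universe u

namespace Literature.AnabelianGeometry.AbsoluteAnabelian

/-! ### §3. `Res : H^q(G, μ_Ẑ(G)) → H^q(H, μ_Ẑ(H))` along an arbitrary injective open `β : H ↪ G` -/

section Cohomology

open _root_.TopRep _root_.ContRepresentation _root_.ContinuousCohomology

variable {G : Type u} [Group G] [TopologicalSpace G] [IsTopologicalGroup G] [CompactSpace G] [T2Space G]
  {H : Type u} [Group H] [TopologicalSpace H] [IsTopologicalGroup H] [CompactSpace H] [T2Space H]
  {K : Type u} [Group K] [TopologicalSpace K] [IsTopologicalGroup K] [CompactSpace K] [T2Space K]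
  (f : H →ₜ* G) (hinj : Injective f) (hf : IsOpen (Set.range f))

/-- **The coefficient morphism `μ_Ẑ(G)|_H → μ_Ẑ(H)`** over an injective open `β : H → G` (inverse of
`μ_Ẑ(β)`; continuous, `β`-equivariant), as a morphism of topological representations — the general-`β` form
of abc-iut-w5-d201's `galCyclotomeResCoeff`. [cite: MochizukiAbsTopIII2015, Remark 1.10.1 p.44] -/
def galCyclotomeResOECoeff :
    TopRep.res (f : H →* G) (galCyclotomeTopRep G) ⟶ galCyclotomeTopRep H :=
  TopRep.ofHom ⟨⟨(MuZhatMod.mapOfOpenEmbeddingInv f hinj hf).toIntLinearMap,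
      MuZhatMod.continuous_mapOfOpenEmbeddingInv _ _ _⟩, fun σ => by
    refine ContinuousLinearMap.ext fun m => ?_
    exact MuZhatMod.mapOfOpenEmbeddingInv_act f hinj hf σ m⟩

omit [T2Space H] in
/-- `galCyclotomeResOECoeff` on elements. [cite: MochizukiAbsTopIII2015, Remark 1.10.1 p.44] -/
@[simp] theorem galCyclotomeResOECoeff_hom_apply (m : MuZhatMod G) :
    (galCyclotomeResOECoeff f hinj hf).hom m = MuZhatMod.mapOfOpenEmbeddingInv f hinj hf m := rfl

/-- **`Res_β : H^q(G, μ_Ẑ(G)) → H^q(H, μ_Ẑ(H))` along an ARBITRARY injective open homomorphism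
`β : H ↪ G`** of compact Hausdorff groups («the asserted "functoriality" is with respect to arbitrary
injective open homomorphisms of profinite groups», Cor. 1.10 (i) p. 42; Rmk. 1.10.1 (iii)): pull back along
`β`, change coefficients along `μ_Ẑ(G) ⥲ μ_Ẑ(H)`. [cite: MochizukiAbsTopIII2015, Remark 1.10.1 p.44] -/
def galCyclotomeResOE (q : ℕ) :
    continuousCohomology q (galCyclotomeTopRep G) ⟶ continuousCohomology q (galCyclotomeTopRep H) :=
  ContinuousCohomology.map f (galCyclotomeResOECoeff f hinj hf) q

omit [T2Space H] in
/-- `galCyclotomeResOE` only depends on the underlying function of `β` (proof-irrelevance of the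
injectivity/openness witnesses included). [cite: MochizukiAbsTopIII2015, Remark 1.10.1 p.44] -/
theorem galCyclotomeResOE_congr {f f' : H →ₜ* G} (h : ∀ x, f x = f' x) (hinj : Injective f)
    (hf : IsOpen (Set.range f)) (hinj' : Injective f') (hf' : IsOpen (Set.range f')) (q : ℕ) :
    galCyclotomeResOE f hinj hf q = galCyclotomeResOE f' hinj' hf' q := by
  obtain rfl : f = f' := ContinuousMonoidHom.ext h
  rfl

/-- **abc-iut-w5-d201's field-theoretic `galCyclotomeRes k k′ q` IS `galCyclotomeResOE` at
`β = res : G_{k′} ↪ G_k`** (definitionally). [cite: MochizukiAbsTopIII2015, Remark 1.10.1 p.44] -/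
theorem galCyclotomeRes_eq_galCyclotomeResOE (k k' : Type u) [Field k] [CharZero k] [Field k'] [CharZero k']
    [Algebra k k'] [FiniteDimensional k k'] (q : ℕ) :
    galCyclotomeRes k k' q =
      galCyclotomeResOE (Literature.NumberTheory.GaloisRepresentations.absGaloisRestrict k k')
        (Literature.NumberTheory.GaloisRepresentations.absGaloisRestrict_injective k k')
      (isOpen_range_absGaloisRestrict k k') q := rfl

omit [T2Space K] in
/-- The coefficient morphisms compose: `μ_Ẑ(f ∘ g)⁻¹ = μ_Ẑ(g)⁻¹ ∘ μ_Ẑ(f)⁻¹|_K` as morphisms of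
topological `K`-representations. [cite: MochizukiAbsTopIII2015, Remark 1.10.1 p.44] -/
theorem galCyclotomeResOECoeff_comp (g : K →ₜ* H) (hginj : Injective g) (hg : IsOpen (Set.range g))
    (hinj' : Injective (f.comp g)) (hf' : IsOpen (Set.range (f.comp g))) :
    galCyclotomeResOECoeff (f.comp g) hinj' hf' =
      (resFunctor (g : K →* H)).map (galCyclotomeResOECoeff f hinj hf) ≫ galCyclotomeResOECoeff g hginj hg :=
  TopRep.hom_ext (ContIntertwiningMap.ext (ContinuousLinearMap.ext fun m =>
    MuZhatMod.mapOfOpenEmbeddingInv_comp g hginj hg f hinj hf hinj' hf' m))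

omit [T2Space K] in
/-- **Contravariant functoriality: `Res_{f ∘ g} = Res_g ∘ Res_f`.**
[cite: MochizukiAbsTopIII2015, Remark 1.10.1 p.44] -/
theorem galCyclotomeResOE_comp (g : K →ₜ* H) (hginj : Injective g) (hg : IsOpen (Set.range g))
    (hinj' : Injective (f.comp g)) (hf' : IsOpen (Set.range (f.comp g))) (q : ℕ) :
    galCyclotomeResOE (f.comp g) hinj' hf' q =
      galCyclotomeResOE f hinj hf q ≫ galCyclotomeResOE g hginj hg q := by
  change ContinuousCohomology.map (f.comp g) (galCyclotomeResOECoeff (f.comp g) hinj' hf') q =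
    ContinuousCohomology.map f (galCyclotomeResOECoeff f hinj hf) q ≫
      ContinuousCohomology.map g (galCyclotomeResOECoeff g hginj hg) q
  rw [galCyclotomeResOECoeff_comp f hinj hf g hginj hg hinj' hf']
  exact ContinuousCohomology.map_comp f g (galCyclotomeResOECoeff f hinj hf) (galCyclotomeResOECoeff g hginj hg) q

omit [T2Space G] in
/-- Along an isomorphism `α : G ≃ₜ* G′`, the coefficient morphism over `α⁻¹ : G′ → G` is abc-iut-L4-d1's
`galCyclotomeResHom α`. [cite: MochizukiAbsTopIII2015, Cor 1.10 (i) p.42] -/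
theorem galCyclotomeResOECoeff_coe_symm {G' : Type u} [Group G'] [TopologicalSpace G'] [IsTopologicalGroup G']
    [CompactSpace G'] [T2Space G'] [T2Space G] (α : G ≃ₜ* G')
    (hinj' : Injective (α.symm : G' →ₜ* G)) (hf' : IsOpen (Set.range (α.symm : G' →ₜ* G))) :
    galCyclotomeResOECoeff (α.symm : G' →ₜ* G) hinj' hf' = galCyclotomeResHom α :=
  TopRep.hom_ext (ContIntertwiningMap.ext (ContinuousLinearMap.ext fun m => by
    change MuZhatMod.mapOfOpenEmbeddingInv (α.symm : G' →ₜ* G) hinj' hf' m = MuZhatMod.congrL α m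
    rw [MuZhatMod.mapOfOpenEmbeddingInv_coe_continuousMulEquiv]
    rfl))

omit [T2Space G] in
/-- **Along an ISOMORPHISM, `Res_{α⁻¹}` is abc-iut-L4-d1's transport `galCyclotomeCohomologyMap α`.**
[cite: MochizukiAbsTopIII2015, Cor 1.10 (i) p.42] -/
theorem galCyclotomeResOE_coe_symm_apply {G' : Type u} [Group G'] [TopologicalSpace G']
    [IsTopologicalGroup G'] [CompactSpace G'] [T2Space G'] [T2Space G] (α : G ≃ₜ* G')
    (hinj' : Injective (α.symm : G' →ₜ* G)) (hf' : IsOpen (Set.range (α.symm : G' →ₜ* G))) (q : ℕ)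
    (x : continuousCohomology q (galCyclotomeTopRep G)) :
    (galCyclotomeResOE (α.symm : G' →ₜ* G) hinj' hf' q).hom x = galCyclotomeCohomologyMap α q x := by
  unfold galCyclotomeResOE
  rw [galCyclotomeResOECoeff_coe_symm]
  rfl

omit [IsTopologicalGroup G] [CompactSpace G] [T2Space G] in
/-- The injectivity witness for an isomorphism viewed as an open injection.
[cite: MochizukiAbsTopIII2015, Cor 1.10 (i) p.42] -/
theorem injective_coe_continuousMulEquiv {G' : Type u} [Group G'] [TopologicalSpace G'] (α : G ≃ₜ* G') :
    Injective (α : G →ₜ* G') := α.injective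

omit [IsTopologicalGroup G] [CompactSpace G] [T2Space G] in
/-- The open-range witness for an isomorphism viewed as an open injection.
[cite: MochizukiAbsTopIII2015, Cor 1.10 (i) p.42] -/
theorem isOpen_range_coe_continuousMulEquiv {G' : Type u} [Group G'] [TopologicalSpace G'] (α : G ≃ₜ* G') :
    IsOpen (Set.range (α : G →ₜ* G')) := by
  have : Set.range (α : G →ₜ* G') = Set.univ := Set.eq_univ_of_forall fun y => ⟨α.symm y, α.apply_symm_apply y⟩
  rw [this]; exact isOpen_univ

/-- **Along an INNER automorphism `x ↦ τ⁻¹ x τ`, the coefficient morphism is the action of `τ`** — so that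
`(β, μ_Ẑ(β)⁻¹)` is the compatible pair of Serre's «inner automorphisms act trivially on cohomology»
(`ContinuousCohomology.map_one_eq_id_of_inner` / `map_two_eq_id_of_inner`).
[cite: MochizukiAbsTopIII2015, Cor 1.10 (i) p.42] -/
theorem galCyclotomeResOECoeff_of_forall_eq_conj (τ : G) (φ : G →ₜ* G) (hφ : ∀ x, φ x = τ⁻¹ * x * τ)
    (hinj' : Injective φ) (hf' : IsOpen (Set.range φ)) (m : MuZhatMod G) :
    (galCyclotomeResOECoeff φ hinj' hf').hom m = (galCyclotomeTopRep G).ρ τ m := by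
  rw [galCyclotomeResOECoeff_hom_apply, MuZhatMod.mapOfOpenEmbeddingInv_of_forall_eq_conj τ φ hφ]
  rfl

omit [IsTopologicalGroup G] [CompactSpace G] [T2Space G] in
/-- The injectivity witness for an inner automorphism. [cite: MochizukiAbsTopIII2015, Cor 1.10 (i) p.42] -/
theorem injective_of_forall_eq_conj (τ : G) (φ : G →ₜ* G) (hφ : ∀ x, φ x = τ⁻¹ * x * τ) : Injective φ := by
  intro a b hab
  rw [hφ, hφ] at hab
  simpa using hab

omit [IsTopologicalGroup G] [CompactSpace G] [T2Space G] in
/-- The open-range witness for an inner automorphism. [cite: MochizukiAbsTopIII2015, Cor 1.10 (i) p.42] -/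
theorem isOpen_range_of_forall_eq_conj (τ : G) (φ : G →ₜ* G) (hφ : ∀ x, φ x = τ⁻¹ * x * τ) :
    IsOpen (Set.range φ) := by
  have : Set.range φ = Set.univ := Set.eq_univ_of_forall fun y => ⟨τ * y * τ⁻¹, by rw [hφ]; group⟩
  rw [this]; exact isOpen_univ

end Cohomology

end Literature.AnabelianGeometry.AbsoluteAnabelian
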